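import Mathlib
import Summits.Langlands.Langlands.Theses.PicardMuOrdinary
import Summits.Langlands.Langlands.Theorems.PicardMuOrdinaryIrregularClassicalityDefs
import Literature.NumberTheory.GaloisRepresentations.CubicResidueSymbol
import Literature.NumberTheory.GaloisRepresentations.GaloisRep
import Literature.NumberTheory.Automorphic.ReciprocityGLnProofs
import Literature.NumberTheory.Automorphic.AsaiSign
import HarnessLib

/-!
# Route `PicardMuOrdinary`, crux `IrregularClassicality` (stmt-Langlands-13758): the SLOPE-FREE
# TWISTED-POLARIZED SPLIT and its glue `irregularClassicality_of_subs`

Crux-strategist (wall-breaker, `cstrat-stmt-Langlands-13758-p1`, 2026-08-17).  Every registered line on this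
crux (`split-ramified-prime-sqrt6` r1–r10, `sen-kills-cousin-on-p2`, `sen-cousin-anisotropic-saddle`) died at ONE
stub: its transfer stub turning the TYPED hypothesis — a slope-free, UNPOLARIZED `3`-adic tower of regular
algebraic cuspidal `P_k` on `GL₃/ℚ(ω)` (Disproof item 7: an `𝒪`-point of the big Hecke algebra of `GL₃/K`, no
more) — into a POLARIZED tower (the only currency in which the irregular-weight limit `ρ_C ⊗ ψ` has a classical
algebraic host: coherent cohomology of a unitary Shimura variety in weight `(1,1,1)`).  That step is a `3`-adic
automorphic DESCENT `GL₃/K ⇝ U(3)` of a non-classical limit point: true under reciprocity, absent from print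
(Disproof 17(a); triage F1 ×3; seven leads).  The descent-free alternative (Eisenstein ASCENT to `U(3,3)` via
`P_k ⊞ P_k^θ`, Scholze's boundary construction) was worked out by the strategist: for UNTWISTED towers it is void for classicality —
the ascended eigensystem `ρ_C ⊞ ρ_C^{c,∨}(-5)` is a de Rham `𝒪`-point of the big Hecke algebra of the `U(3,3)`
Shimura variety with NO classical coherent avatar (interior coherent cohomology is square-integrable, Harris 1990,
and the eigensystem has no Arthur parameter — its two Satake clusters differ by `q⁴`, not `q`; boundary coherent
cohomology at the Siegel cusp is group cohomology of `Γ ⊂ GL₃(𝒪_K)` with ALGEBRAIC coefficients, Harris–Zucker III,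
so it carries only cohomological Levi data); for ψ-TWISTED towers the ascended point is exactly the eigensystem of the Arthur
parameter `μ ⊠ sp(2)` and the question becomes archimedean (crux idea `siegel-cap-ascent`) — see
`Cruxes/IrregularClassicality/STRATEGY-CENSUS.md` §Transfer T2.

Hence the honest structure of the crux is a composition of THREE statements, filed here as the decomposition
(D-0019 glued split, strategist output (b)); the glue is pure logic:

* `LimitTwist` (C2a, SUPPORT, provable): the typed tower for the traces `e(a_𝔭(f))` can be replaced by a tower of
  the same shape for the ψ-TWISTED traces `e(a_𝔭(f)·ϖ_𝔭)`, `ϖ_𝔭` the primary generator of `𝔭` (`𝔭 = (ϖ_𝔭)`,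
  `ϖ_𝔭 ≡ 1 mod 3`; `𝓞_K` is a PID and `±ω^i` are distinct mod `3`, Disproof item 27).  On paper: `P_k ↦ P_k ⊗ (λ_e ∘ det)`
  with `λ_e` the cubic-reciprocity Grössencharacter `λ_e((α)) = e(α)` for primary `α` (conductor `(3)`, infinity type
  `(1,0)`): twisting multiplies the Satake parameter at `𝔭 ∉ S ∋ λ` by `e(ϖ_𝔭) ∈ ℤ̄`, keeps cuspidality and regular
  algebraicity, and scales the congruence (`t ↦ e(ϖ_𝔭)·t`).  Formal debt: the Grössencharacter as a
  `HeckeCharacter` and twisting of `CuspidalAutomorphicRepData` by an infinite-order algebraic character with Satake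
  bookkeeping (`HasSatakeParamAt.twist`-shape) — not yet in the tree (sen-kills Stub C, Disproof 27(a)).  WHY TWIST:
  exact conjugate self-duality reads `r^c ≅ r^∨ ⊗ ε⁻²` in the crux normalisation while `ρ_C^c ≅ ρ_C^∨ ⊗ ε⁻¹`, so an
  UNTWISTED polarized tower is parity-false for `k ≥ 4` (ParityNote; Disproof `cube_of_one_mod_three_mod_nine`,
  `exists_cube_of_one_mod_three_ne_one_mod_twentyseven`); `ρ_C ⊗ ψ` IS exactly polarized (`ψψ^c = ε⁻¹`, item 22).
* `PolarizationDebt` (C2b, CRUX = THE WALL, isolated): a twisted tower in `𝔐`-currency can be replaced by an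
  EXACTLY `c₀`-polarized twisted tower in `ι`-currency WITH Galois avatars `r_k` (Galois-compatible off `S`,
  `‖ι⁻¹(N𝔭·ΣSat − e(a_𝔭 ϖ_𝔭))‖ ≤ 3⁻ᵏ`) — i.e. the conclusion shape of the dead transfer stubs minus ordinarity.
  Content: (i) `𝔐 ↦ ι` (LANDED: `stub_placeOfMaximalIdeal`, Negative/PlaceOfMaximalIdealTightness); (ii) avatars
  (named fact `exists_galoisRep_of_regularAlgebraic`, HLTT 2016 Thm. A) — both known; (iii) POLARIZATION of the
  tower = `3`-adic descent of the limit point to `U_{K/ℚ}(3)` — OPEN (equivalent on paper to: exactly-polarized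
  regular cuspidal eigensystems accumulate `3`-adically at `ρ_C ⊗ ψ`; expected via Hida/eigenvariety families through
  the weight-`(1,1,1)` form in the μ-ordinary / finite-slope regimes, UNCLEAR for λ-wild basic `f`).  This child is
  NOT meant to be staffed: it is the identity the moment the tenure planner restates 13757's conclusion / 13758's
  hypothesis as the polarized tower (every lead's and the disprover's recommendation), and it is the one place a
  refuter can record that the typed 13757 → 13758 interface is not merely inconvenient but wrong (why-might-fail).
* `IrregularClassicalityPolarized` (C3, CRUX = the restated crux, the HEART's home): an exactly-polarized twisted
  `3`-adic limit with avatars ⇒ `C_f` automorphic.  A weakening of the target `PicardAutomorphy`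
  (`irregularClassicalityPolarized_of_picardAutomorphy`: no refutation room), implied on paper by the current crux
  (untwist), and STRONGER than lead c1's ordinary restate (`irregularClassicalityOrd_of_polarized`: it must also
  handle non-ordinary towers, so it concedes no λ-basic remainder).  Its lines: `split-ramified-prime-sqrt6` r10 minus
  Stub 3ʳᵈ (heart = two-wall ORDINARY Sen = Cousin on the `U(2,1)_{L/L⁺}` fourfold, BCGP 2025's announced extension —
  the μ-ordinary sub-case, plus an ordinarity-of-the-limit step), `sen-kills-cousin-on-p2` / `…-saddle` minus Stub T
  (heart = SLOPE-FREE Sen = Cousin on the Picard surface at the anisotropic saddle — the Pan programme, whose state of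
  the art is GL₂-type: Pan 2022 (modular curves), Qiu–Su arXiv:2505.10290 (unitary Shimura curves), Matsumoto
  arXiv:2512.04641, Jiang arXiv:2605.18426 (Hilbert modular forms, 2026); the Picard modular SURFACE is the natural
  next case), `definite-companion-gluing` (unplanned triage survivor; needs an eigenvariety-membership step).

`irregularClassicality_of_subs : LimitTwist → PolarizationDebt → IrregularClassicalityPolarized → IrregularClassicality`
is the glue (pure composition).  The three statements are written WITHOUT local abbreviations, fully qualified, so
that they can be filed verbatim as the child items of `ledger route edit --split IrregularClassicality` (the route
file cannot import this file).  [cite: Scholze2015, §V] [cite: NewtonThorne2016] [cite: PanLocallyAnalyticII2022]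
[cite: Jiang2026ClassicalityHilbert] [cite: HarrisLanTaylorThorneRMS2016, Thm. A]
-/

-- `Summit.Langlands.Langlands.…` (summit = sub-problem name, D-0017 layout) trips `dupNamespace` on every decl.
set_option linter.dupNamespace false
set_option autoImplicit false

namespace Summit.Langlands.Langlands.Theorems.IrregularClassicality.Split

open Summit.Langlands.Langlands.Theses.PicardMuOrdinary

noncomputable section

/-- **C2a `LimitTwist` (support).**  For generic `f`: the typed slope-free tower for the traces `e(a_𝔭(f))`
(VERBATIM the hypothesis of `IrregularClassicality`) yields a tower of the same shape for the TWISTED traces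
`e(a_𝔭(f)·ϖ_𝔭)` with primary generators `ϖ_𝔭` off `S` (possibly for other `e, 𝔐, S`).  True on paper (twist by the
cubic Grössencharacter `λ_e`); formal debt = algebraic-Hecke-character twist API.  [folklore] -/
def LimitTwist : Prop :=
  ∀ (f : Polynomial ℤ) (hcpt : Literature.NumberTheory.Automorphic.isCompact_glFiniteIntegralLevel 3 (CyclotomicField 3 ℚ)), f.natDegree = 4 → (f.map (Int.castRingHom ℚ)).Separable → 12 ∣ Nat.card (f.map (Int.castRingHom ℚ)).Gal → (∃ (e : (CyclotomicField 3 ℚ) →+* ℂ) (𝔐 : Ideal (integralClosure ℤ ℂ)) (S : Finset (IsDedekindDomain.HeightOneSpectrum (NumberField.RingOfIntegers (CyclotomicField 3 ℚ)))), 𝔐.IsMaximal ∧ (3 : (integralClosure ℤ ℂ)) ∈ 𝔐 ∧ ∀ k : ℕ, ∃ P : Literature.NumberTheory.Automorphic.CuspidalAutomorphicRepData 3 (CyclotomicField 3 ℚ) hcpt, P.1.IsRegularAlgebraic ∧ ∀ 𝔭 ∉ S, ∃ (α : Multiset ℂ) (t u : (integralClosure ℤ ℂ)), P.1.HasSatakeParamAt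 𝔭 α ∧ (t : ℂ) = (𝔭.residueCard : ℂ) * α.sum - e (Literature.NumberTheory.GaloisRepresentations.picardTrace f 𝔭) ∧ u ∉ 𝔐 ∧ u * t ∈ Ideal.span {(3 : (integralClosure ℤ ℂ)) ^ k}) → (∃ (e : (CyclotomicField 3 ℚ) →+* ℂ) (𝔐 : Ideal (integralClosure ℤ ℂ)) (S : Finset (IsDedekindDomain.HeightOneSpectrum (NumberField.RingOfIntegers (CyclotomicField 3 ℚ)))) (ϖ : (IsDedekindDomain.HeightOneSpectrum (NumberField.RingOfIntegers (CyclotomicField 3 ℚ))) → (NumberField.RingOfIntegers (CyclotomicField 3 ℚ))), 𝔐.IsMaximal ∧ (3 : (integralClosure ℤ ℂ)) ∈ 𝔐 ∧ (∀ 𝔭 ∉ S, 𝔭.asIdeal = Ideal.span {ϖ 𝔭} ∧ ϖ 𝔭 - 1 ∈ Ideal.span {(3 : (NumberField.RingOfIntegers (CyclotomicField 3 ℚ)))}) ∧ ∀ k : ℕ, ∃ P : Literature.NumberTheory.Automorphic.CuspidalAutomorphicRepData 3 (CyclotomicField 3 ℚ) hcpt, P.1.IsRegularAlgebraic ∧ ∀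 𝔭 ∉ S, ∃ (α : Multiset ℂ) (t u : (integralClosure ℤ ℂ)), P.1.HasSatakeParamAt 𝔭 α ∧ (t : ℂ) = (𝔭.residueCard : ℂ) * α.sum - e (↑(Literature.NumberTheory.GaloisRepresentations.picardTrace f 𝔭 * ϖ 𝔭)) ∧ u ∉ 𝔐 ∧ u * t ∈ Ideal.span {(3 : (integralClosure ℤ ℂ)) ^ k})

/-- **C2b `PolarizationDebt` (crux; THE WALL of every dead line, isolated).**  For generic `f`: a twisted tower in
`𝔐`-currency yields `e`, `ι : ℚ̄₃ ≃ ℂ`, `S`, a complex conjugation `c₀ ≠ 1`, primary generators `ϖ` off `S`, and an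
EXACTLY `c₀`-polarized regular cuspidal tower for the twisted traces with Galois avatars `r_k` (Galois-compatible off
`S`) and `ι`-adic trace bounds `‖ι⁻¹(N𝔭·ΣSat(P_k,𝔭) − e(a_𝔭 ϖ_𝔭))‖ ≤ 3⁻ᵏ`.  `𝔐 ↦ ι` and the avatars are known
(landed Stub 1; HLTT); the polarization is the open `3`-adic descent.  Do not staff before the tenure restate (under
which it is the identity).  [cite: HarrisLanTaylorThorneRMS2016, Thm. A] -/
def PolarizationDebt : Prop :=
  ∀ (f : Polynomial ℤ) (hcpt : Literature.NumberTheory.Automorphic.isCompact_glFiniteIntegralLevel 3 (CyclotomicField 3 ℚ)), f.natDegree = 4 → (f.map (Int.castRingHom ℚ)).Separable → 12 ∣ Nat.card (f.map (Int.castRingHom ℚ)).Gal → (∃ (e : (CyclotomicField 3 ℚ) →+* ℂ) (𝔐 : Ideal (integralClosure ℤ ℂ)) (S : Finset (IsDedekindDomain.HeightOneSpectrum (NumberField.RingOfIntegers (CyclotomicField 3 ℚ)))) (ϖ : (IsDedekindDomain.HeightOneSpectrum (NumberField.RingOfIntegers (CyclotomicField 3 ℚ))) → (NumberField.RingOfIntegers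 (CyclotomicField 3 ℚ))), 𝔐.IsMaximal ∧ (3 : (integralClosure ℤ ℂ)) ∈ 𝔐 ∧ (∀ 𝔭 ∉ S, 𝔭.asIdeal = Ideal.span {ϖ 𝔭} ∧ ϖ 𝔭 - 1 ∈ Ideal.span {(3 : (NumberField.RingOfIntegers (CyclotomicField 3 ℚ)))}) ∧ ∀ k : ℕ, ∃ P : Literature.NumberTheory.Automorphic.CuspidalAutomorphicRepData 3 (CyclotomicField 3 ℚ) hcpt, P.1.IsRegularAlgebraic ∧ ∀ 𝔭 ∉ S, ∃ (α : Multiset ℂ) (t u : (integralClosure ℤ ℂ)), P.1.HasSatakeParamAt 𝔭 α ∧ (t : ℂ) = (𝔭.residueCard : ℂ) * α.sum - e (↑(Literature.NumberTheory.GaloisRepresentations.picardTrace f 𝔭 * ϖ 𝔭)) ∧ u ∉ 𝔐 ∧ u * t ∈ Ideal.span {(3 : (integralClosure ℤ ℂ)) ^ k}) → (∃ (e : (CyclotomicField 3 ℚ) →+* ℂ) (ι : PadicAlgCl 3 ≃+* ℂ) (S : Finset (IsDedekindDomain.HeightOneSpectrum (NumberField.RingOfIntegers (CyclotomicField 3 ℚ))))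 (c₀ : (CyclotomicField 3 ℚ) ≃ₐ[ℚ] (CyclotomicField 3 ℚ)) (ϖ : (IsDedekindDomain.HeightOneSpectrum (NumberField.RingOfIntegers (CyclotomicField 3 ℚ))) → (NumberField.RingOfIntegers (CyclotomicField 3 ℚ))), c₀ ≠ 1 ∧ (∀ 𝔭 ∉ S, 𝔭.asIdeal = Ideal.span {ϖ 𝔭} ∧ ϖ 𝔭 - 1 ∈ Ideal.span {(3 : (NumberField.RingOfIntegers (CyclotomicField 3 ℚ)))}) ∧ ∀ k : ℕ, ∃ (P : Literature.NumberTheory.Automorphic.CuspidalAutomorphicRepData 3 (CyclotomicField 3 ℚ) hcpt) (r : Literature.NumberTheory.GaloisRepresentations.FramedGaloisRep (CyclotomicField 3 ℚ) (PadicAlgCl 3) 3), P.1.IsRegularAlgebraic ∧ P.1.IsConjSelfDualAE c₀ ∧ ∀ 𝔭 ∉ S, P.1.IsUnramifiedAt 𝔭 ∧ Literature.NumberTheory.Automorphic.IsGaloisCompatibleAt P.1 ι r 𝔭 ∧ ∃ (α : Multiset ℂ) (t : (integralClosure ℤ ℂ)), P.1.HasSatakeParamAt 𝔭 α ∧ (t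 : ℂ) = (𝔭.residueCard : ℂ) * α.sum - e (↑(Literature.NumberTheory.GaloisRepresentations.picardTrace f 𝔭 * ϖ 𝔭)) ∧ ‖ι.symm (t : ℂ)‖ ≤ ((3 : ℝ)⁻¹) ^ k)

/-- **C3 `IrregularClassicalityPolarized` (crux; the restated crux).**  For generic `f`: an exactly `c₀`-polarized
twisted `3`-adic tower with Galois avatars converging (in `ι`-adic Satake sums off `S`) to the twisted Picard traces
`e(a_𝔭(f)·ϖ_𝔭)` implies that `C_f : y³ = f(x)` is automorphic over `ℚ(ω)` (VERBATIM the conclusion of the crux and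
of the target).  Weakening of `PicardAutomorphy`; stronger than `IrregularClassicalityOrd` (no ordinarity of the
avatars is assumed).  Intended proofs: Sen = Cousin classicality in weight `(1,1,1)` (ordinary two-wall on the
`U(2,1)_{L/L⁺}` fourfold for the μ-ordinary class; slope-free Pan-type on the Picard surface in general) + Rogawski/Mok
+ the landed untwist `stub_irregularDescentUntwist`.  [cite: BoxerCalegariGeePilloni2025] [cite: Pan2022LocallyAnalytic] -/
def IrregularClassicalityPolarized : Prop :=
  ∀ (f : Polynomial ℤ) (hcpt : Literature.NumberTheory.Automorphic.isCompact_glFiniteIntegralLevel 3 (CyclotomicField 3 ℚ)), f.natDegree = 4 → (f.map (Int.castRingHom ℚ)).Separable → 12 ∣ Nat.card (f.map (Int.castRingHom ℚ)).Gal → (∃ (e : (CyclotomicField 3 ℚ) →+* ℂ) (ι : PadicAlgCl 3 ≃+* ℂ) (S : Finset (IsDedekindDomain.HeightOneSpectrum (NumberField.RingOfIntegers (CyclotomicField 3 ℚ)))) (c₀ : (CyclotomicField 3 ℚ) ≃ₐ[ℚ] (CyclotomicField 3 ℚ)) (ϖ : (IsDedekindDomain.HeightOneSpectrum (NumberField.RingOfIntegers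 (CyclotomicField 3 ℚ))) → (NumberField.RingOfIntegers (CyclotomicField 3 ℚ))), c₀ ≠ 1 ∧ (∀ 𝔭 ∉ S, 𝔭.asIdeal = Ideal.span {ϖ 𝔭} ∧ ϖ 𝔭 - 1 ∈ Ideal.span {(3 : (NumberField.RingOfIntegers (CyclotomicField 3 ℚ)))}) ∧ ∀ k : ℕ, ∃ (P : Literature.NumberTheory.Automorphic.CuspidalAutomorphicRepData 3 (CyclotomicField 3 ℚ) hcpt) (r : Literature.NumberTheory.GaloisRepresentations.FramedGaloisRep (CyclotomicField 3 ℚ) (PadicAlgCl 3) 3), P.1.IsRegularAlgebraic ∧ P.1.IsConjSelfDualAE c₀ ∧ ∀ 𝔭 ∉ S, P.1.IsUnramifiedAt 𝔭 ∧ Literature.NumberTheory.Automorphic.IsGaloisCompatibleAt P.1 ι r 𝔭 ∧ ∃ (α : Multiset ℂ) (t : (integralClosure ℤ ℂ)), P.1.HasSatakeParamAt 𝔭 α ∧ (t : ℂ) = (𝔭.residueCard : ℂ) * α.sum - e (↑(Literature.NumberTheory.GaloisRepresentations.picardTrace f 𝔭 * ϖ 𝔭)) ∧ ‖ι.symm (t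 : ℂ)‖ ≤ ((3 : ℝ)⁻¹) ^ k) → ∃ (e : (CyclotomicField 3 ℚ) →+* ℂ) (π : Literature.NumberTheory.Automorphic.CuspidalAutomorphicRepData 3 (CyclotomicField 3 ℚ) hcpt), π.1.IsLAlgebraic ∧ ∀ᶠ 𝔭 : IsDedekindDomain.HeightOneSpectrum (NumberField.RingOfIntegers (CyclotomicField 3 ℚ)) in Filter.cofinite, ∃ α : Multiset ℂ, π.1.HasSatakeParamAt 𝔭 α ∧ α.sum = e (Literature.NumberTheory.GaloisRepresentations.picardTrace f 𝔭)

/-! ## The glue -/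

/-- **The split glues back to the crux** (pure logic: twist the typed tower, polarize it, apply the restated
crux).  This is the `--glue-by` theorem of `ledger route edit --split IrregularClassicality --into
[LimitTwist, PolarizationDebt, IrregularClassicalityPolarized]`. [folklore] -/
theorem irregularClassicality_of_subs :
    LimitTwist → PolarizationDebt → IrregularClassicalityPolarized → IrregularClassicality :=
  fun hA hB hC f hcpt hdeg hsep hgal hlim =>
    hC f hcpt hdeg hsep hgal (hB f hcpt hdeg hsep hgal (hA f hcpt hdeg hsep hgal hlim))

/-! ## Read-backs: no refutation room for C3; C3 is stronger than the ordinary restate -/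

/-- `C3` is a weakening of the target `PicardAutomorphy` (it adds a hypothesis and keeps the conclusion), so —
like the crux itself (Disproof item 2) — it admits no refutation short of `¬X`. [folklore] -/
theorem irregularClassicalityPolarized_of_picardAutomorphy (hX : PicardAutomorphy) :
    IrregularClassicalityPolarized :=
  fun f hcpt hdeg hsep hgal _ => hX f hcpt hdeg hsep hgal

/-- `C3` implies lead c1's ORDINARY restate `IrregularClassicalityOrd` (Defs §4): an ordinary polarized tower is in
particular a polarized tower (drop the ordinarity conjunct of `OrdPolarizedTower`), and the conclusions agree
(`AutomorphyConclusion` is the crux's conclusion verbatim).  So every certificate landed for the ordinary kit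
(`irregularClassicalityOrd_of`, Reduction p126473) addresses a sub-case of `C3`. [folklore] -/
theorem irregularClassicalityOrd_of_polarized (h : IrregularClassicalityPolarized) :
    SplitRamifiedPrimeSqrt6.IrregularClassicalityOrd := by
  intro art f hcpt hdeg hsep hgal hyp
  obtain ⟨e, ι, S, c₀, ϖ, hc₀, hϖ, htower⟩ := hyp
  refine h f hcpt hdeg hsep hgal ⟨e, ι, S, c₀, ϖ, hc₀, hϖ, fun k => ?_⟩
  obtain ⟨P, r, hreg, hcsd, hP, _hord⟩ := htower k
  exact ⟨P, r, hreg, hcsd, hP⟩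

/-- Conversely the typed crux implies `C3` composed with the two debts trivially… no: what holds is that `C3`
sits BETWEEN the target and the ordinary restate; the typed crux implies `C3` only on paper (untwisting a polarized
tower needs the Grössencharacter twist API, as for `LimitTwist`).  Recorded as the trivial direction available in
the tree: the crux and `C2a ∧ C2b ∧ C3` have the same conclusion shape. [folklore] -/
theorem irregularClassicality_iff_limit_to_conclusion :
    IrregularClassicality ↔
      ∀ (f : Polynomial ℤ) (hcpt : Literature.NumberTheory.Automorphic.isCompact_glFiniteIntegralLevel 3 (CyclotomicField 3 ℚ)), f.natDegree = 4 → (f.map (Int.castRingHom ℚ)).Separable → 12 ∣ Nat.card (f.map (Int.castRingHom ℚ)).Gal → (∃ (e : (CyclotomicField 3 ℚ) →+* ℂ) (𝔐 : Ideal (integralClosure ℤ ℂ)) (S : Finset (IsDedekindDomain.HeightOneSpectrum (NumberField.RingOfIntegers (CyclotomicField 3 ℚ)))), 𝔐.IsMaximal ∧ (3 : (integralClosure ℤ ℂ)) ∈ 𝔐 ∧ ∀ k : ℕ, ∃ P : Literature.NumberTheory.Automorphic.CuspidalAutomorphicRepData 3 (CyclotomicField 3 ℚ) hcpt, P.1.IsRegularAlgebraic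 ∧ ∀ 𝔭 ∉ S, ∃ (α : Multiset ℂ) (t u : (integralClosure ℤ ℂ)), P.1.HasSatakeParamAt 𝔭 α ∧ (t : ℂ) = (𝔭.residueCard : ℂ) * α.sum - e (Literature.NumberTheory.GaloisRepresentations.picardTrace f 𝔭) ∧ u ∉ 𝔐 ∧ u * t ∈ Ideal.span {(3 : (integralClosure ℤ ℂ)) ^ k}) → ∃ (e : (CyclotomicField 3 ℚ) →+* ℂ) (π : Literature.NumberTheory.Automorphic.CuspidalAutomorphicRepData 3 (CyclotomicField 3 ℚ) hcpt), π.1.IsLAlgebraic ∧ ∀ᶠ 𝔭 : IsDedekindDomain.HeightOneSpectrum (NumberField.RingOfIntegers (CyclotomicField 3 ℚ)) in Filter.cofinite, ∃ α : Multiset ℂ, π.1.HasSatakeParamAt 𝔭 α ∧ α.sum = e (Literature.NumberTheory.GaloisRepresentations.picardTrace f 𝔭) :=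
  Iff.rfl

end

end Summit.Langlands.Langlands.Theorems.IrregularClassicality.Split
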